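import Mathlib
import Summits.ValiantsHypothesis.ValiantsHypothesis.Theorems.BarrierLeverPartitionMinorsHitByVPHiddenStatesSymSyzygy

/-!
# Route BarrierLever — item `PartitionMinorsHitByVP` (stmt-ValiantsHypothesis-19717), line `hidden_states`:
# THE SYM²-SYZYGY LAW, UNCONDITIONAL FORM — a nonzero symmetric syzygy matrix with zero diagonal exists for EVERY table once `C(|S|−|T|+1, 2) > |S|`

Helper file (`--supports stmt-ValiantsHypothesis-19717`; cell valiant-natproofs, rung V4, 𝒟-side door (c), line `hidden_states`; prover seat
val-np-p3 gen 22; memo HOME/val-np-p3/g22/MEMO-girth-valnp3-g22.md §8–§9). Bookkeeping `def`s only (`syzMat`, `symOf`, `extendβ`). Closes NO item.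

THE COUNT. For a table `tx`, states `S` and coordinates `T`, the syzygy space `Λ = ker (λ ↦ (a ↦ Σ_{p∈S} λ_p g_p(a))_{a∈T})` has dimension
`d ≥ |S| − |T|` (rank–nullity). For a basis `v_1..v_d` of `Λ` and ANY coefficient function `c` on unordered pairs `Sym2 (Fin d)`, the matrix
`β_c(p,p') = Σ_{i,j} c{i,j} v_i(p) v_j(p')` is symmetric with every column in `Λ`, and `c ↦ β_c` is INJECTIVE (linear independence of the `v_i`,
used twice: `symOf_eq_zero`). The diagonal `c ↦ (β_c(p,p))_p` is a linear map from a space of dimension `C(d+1,2)` to one of dimension `|S|`, so if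
`C(|S|−|T|+1, 2) > |S|` some `c ≠ 0` has zero diagonal (`exists_syzygyMatrix`). With `…HiddenStatesSymSyzygy.det_eq_zero_of_syzygy` this gives the
law in closed form (`det_eq_zero_of_count`): **for EVERY table, a block-additive matrix whose columns contain a complete pair ball on `S` with its
origin and whose rows lie in `B₃(T)` is singular as soon as `C(|S|−|T|+1, 2) > |S|`** (e.g. `|T| = 9`, `|S| ≥ 14`; in general `|S| ≳ |T| + √(2|T|)`,
one state below the `q = 1` pair-span threshold `|T|+1+√(2|T|+2)`; by the same count applied to rank, the deficiency is
`≥ C(|S|−|T|+1,2) − |S|` where the pair-span law gives `C(|S|−|T|,2) − |S|`, i.e. larger by `|S| − |T|`; kit j333612/j333642: the count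
`C(|S|−|T|+1,2) − |S|` is EXACT in all 26 computed single-block cases).

WHAT THIS IS NOT: the rank statement (deficiency count) is not formalised, only the threshold; nothing on joins; item 19717 OPEN; nothing on
crux 14610 or VP ≠ VNP, which is NOT proved.
-/

set_option linter.dupNamespace false

namespace Summit.ValiantsHypothesis.ValiantsHypothesis.Theorems.BarrierLever.HiddenStates

open Finset Matrix Module

noncomputable section

namespace SymSyzygy

variable {h K : ℕ}

section count

variable (tx : Option (Fin K) → Fin h → ℂ) (S : Finset (Fin K)) (T : Finset (Fin h))

/-- The state matrix on `T × S`: entry `(a, p) = g_p(a) = tx (some p) a`. -/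
def syzMat : Matrix ↥T ↥S ℂ := Matrix.of fun a p => tx (some (p : Fin K)) (a : Fin h)

/-- The syzygy space `Λ_T = ker (λ ↦ G λ)` has dimension at least `|S| − |T|`. -/
theorem le_finrank_ker : S.card - T.card ≤ finrank ℂ (LinearMap.ker (syzMat tx S T).mulVecLin) := by
  classical
  have h₁ := (syzMat tx S T).mulVecLin.finrank_range_add_finrank_ker
  have h₂ : finrank ℂ (LinearMap.range (syzMat tx S T).mulVecLin) ≤ finrank ℂ (↥T → ℂ) := Submodule.finrank_le _
  rw [Module.finrank_fintype_fun_eq_card, Fintype.card_coe] at h₁ h₂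
  omega

variable {d : ℕ} (v : Fin d → (↥S → ℂ))

/-- The symmetric matrix built from a coefficient function on unordered pairs: `β_c(p,p') = Σ_{i,j} c{i,j} v_i(p) v_j(p')`. -/
def symOf (c : Sym2 (Fin d) → ℂ) : ↥S → ↥S → ℂ :=
  fun p p' => ∑ i, ∑ j, c s(i, j) * v i p * v j p'

/-- `β_c` is symmetric. -/
theorem symOf_symm (c : Sym2 (Fin d) → ℂ) (p p' : ↥S) : symOf S v c p p' = symOf S v c p' p := by
  unfold symOf
  rw [Finset.sum_comm]
  refine Finset.sum_congr rfl fun j _ => Finset.sum_congr rfl fun i _ => ?_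
  rw [Sym2.eq_swap]; ring

/-- **Injectivity**: if the `v_i` are linearly independent then `β_c = 0 ⇒ c = 0` (linear independence used twice). -/
theorem symOf_eq_zero (hv : LinearIndependent ℂ v) (c : Sym2 (Fin d) → ℂ) (hc : symOf S v c = 0) : c = 0 := by
  classical
  -- the row weights `w_i(p') = Σ_j c{i,j} v_j(p')`
  have hw : ∀ p' : ↥S, ∀ i, ∑ j, c s(i, j) * v j p' = 0 := by
    intro p'
    have hrel : ∑ i, (∑ j, c s(i, j) * v j p') • v i = 0 := by
      funext p
      have := congrFun (congrFun hc p) p'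
      simp only [symOf, Pi.zero_apply] at this
      rw [Finset.sum_apply]
      simp only [Pi.smul_apply, smul_eq_mul, Pi.zero_apply]
      rw [← this]
      refine Finset.sum_congr rfl fun i _ => ?_
      rw [Finset.sum_mul]
      exact Finset.sum_congr rfl fun j _ => by ring
    exact Fintype.linearIndependent_iff.mp hv _ hrel
  funext z
  induction z using Sym2.ind with
  | h i j =>
    have hrel : ∑ j', c s(i, j') • v j' = 0 := by
      funext p'
      rw [Finset.sum_apply]
      simpa [Pi.smul_apply, smul_eq_mul] using hw p' i
    have := Fintype.linearIndependent_iff.mp hv _ hrel j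
    simpa using this

/-- Extension of a matrix on `↥S × ↥S` to `Fin K × Fin K` by zero. -/
def extendβ (β : ↥S → ↥S → ℂ) : Fin K → Fin K → ℂ :=
  fun p p' => if hp : p ∈ S then (if hp' : p' ∈ S then β ⟨p, hp⟩ ⟨p', hp'⟩ else 0) else 0

/-- **EXISTENCE OF A NONZERO SYMMETRIC SYZYGY MATRIX WITH ZERO DIAGONAL, FOR EVERY TABLE**, once `C(|S|−|T|+1, 2) > |S|`. -/
theorem exists_syzygyMatrix (hcount : S.card < Nat.choose (S.card - T.card + 1) 2) :
    ∃ β : Fin K → Fin K → ℂ, (∀ p ∈ S, ∀ p' ∈ S, β p p' = β p' p) ∧ (∀ p ∈ S, β p p = 0) ∧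
      (∀ p' ∈ S, ∀ a ∈ T, ∑ p ∈ S, β p p' * tx (some p) a = 0) ∧ ∃ p ∈ S, ∃ p' ∈ S, β p p' ≠ 0 := by
  classical
  set Λ := LinearMap.ker (syzMat tx S T).mulVecLin with hΛ
  set d := finrank ℂ Λ with hd
  have hdle : S.card - T.card ≤ d := le_finrank_ker tx S T
  let bΛ : Basis (Fin d) ℂ Λ := Module.finBasis ℂ Λ
  let v : Fin d → (↥S → ℂ) := fun i => (bΛ i : ↥S → ℂ)
  have hv : LinearIndependent ℂ v := bΛ.linearIndependent.map' Λ.subtype Λ.ker_subtype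
  have hvΛ : ∀ i, ∀ a : ↥T, ∑ p : ↥S, tx (some (p : Fin K)) a * v i p = 0 := by
    intro i a
    have hmem : (v i) ∈ Λ := (bΛ i).2
    rw [hΛ, LinearMap.mem_ker] at hmem
    have := congrFun hmem a
    simpa [Matrix.mulVecLin_apply, Matrix.mulVec, dotProduct, syzMat] using this
  -- the diagonal map
  let Δ : (Sym2 (Fin d) → ℂ) →ₗ[ℂ] (↥S → ℂ) :=
    { toFun := fun c p => ∑ i, ∑ j, c s(i, j) * v i p * v j p
      map_add' := by
        intro c c'; funext p
        simp only [Pi.add_apply, add_mul, Finset.sum_add_distrib]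
      map_smul' := by
        intro r c; funext p
        simp only [Pi.smul_apply, smul_eq_mul, RingHom.id_apply, Finset.mul_sum]
        refine Finset.sum_congr rfl fun i _ => Finset.sum_congr rfl fun j _ => by ring }
  have hlt : finrank ℂ (↥S → ℂ) < finrank ℂ (Sym2 (Fin d) → ℂ) := by
    rw [Module.finrank_fintype_fun_eq_card, Module.finrank_fintype_fun_eq_card, Fintype.card_coe, Sym2.card, Fintype.card_fin]
    exact lt_of_lt_of_le hcount (Nat.choose_le_choose 2 (by omega))
  obtain ⟨c, hcker, hc0⟩ := Submodule.exists_mem_ne_zero_of_ne_bot (LinearMap.ker_ne_bot_of_finrank_lt (f := Δ) hlt)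
  rw [LinearMap.mem_ker] at hcker
  refine ⟨extendβ S (symOf S v c), ?_, ?_, ?_, ?_⟩
  · intro p hp p' hp'
    simp only [extendβ, dif_pos hp, dif_pos hp']
    exact symOf_symm S v c _ _
  · intro p hp
    have := congrFun hcker ⟨p, hp⟩
    simp only [Δ, LinearMap.coe_mk, AddHom.coe_mk, Pi.zero_apply] at this
    simp only [extendβ, dif_pos hp, symOf]
    exact this
  · intro p' hp' a ha
    -- Σ_{p∈S} β p p' g_p(a) = Σ_i w_i(p') · (Σ_p v_i(p) g_p(a)) = 0
    rw [← Finset.sum_attach S]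
    have hrw : ∀ p : ↥S, extendβ S (symOf S v c) p p' * tx (some (p : Fin K)) a =
        ∑ i, (∑ j, c s(i, j) * v j ⟨p', hp'⟩) * (tx (some (p : Fin K)) a * v i p) := by
      intro p
      simp only [extendβ, dif_pos p.2, dif_pos hp', symOf]
      rw [Finset.sum_mul]
      refine Finset.sum_congr rfl fun i _ => ?_
      rw [Finset.sum_mul, Finset.sum_mul]
      exact Finset.sum_congr rfl fun j _ => by ring
    have hattach : ∑ p ∈ S.attach, extendβ S (symOf S v c) p p' * tx (some (p : Fin K)) a =
        ∑ p : ↥S, extendβ S (symOf S v c) p p' * tx (some (p : Fin K)) a := rfl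
    rw [hattach]
    simp_rw [hrw]
    rw [Finset.sum_comm]
    refine Finset.sum_eq_zero fun i _ => ?_
    rw [← Finset.mul_sum, hvΛ i ⟨a, ha⟩, mul_zero]
  · by_contra hnone
    push Not at hnone
    apply hc0
    apply symOf_eq_zero S v hv c
    funext p p'
    have := hnone p p.2 p' p'.2
    simpa [extendβ, dif_pos p.2, dif_pos p'.2] using this

end count

/-! ## The law in closed form -/

section closed

variable {n : Type*} [Fintype n] [DecidableEq n]

/-- **THE SYM²-SYZYGY LAW (closed form): for EVERY table, a block-additive matrix whose column family contains a complete pair ball on `S`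
with its origin and whose rows lie in `B₃(T)` is singular once `C(|S| − |T| + 1, 2) > |S|`.** -/
theorem det_eq_zero_of_count (tx : Option (Fin K) → Fin h → ℂ) (u : n → Finset (Fin h)) (e : n → Finset (Fin K))
    (he : Function.Injective e) (S : Finset (Fin K)) (T : Finset (Fin h))
    (h0 : ∃ k, e k = ∅) (h1 : ∀ p ∈ S, ∃ k, e k = {p}) (h2 : ∀ p ∈ S, ∀ p' ∈ S, p ≠ p' → ∃ k, e k = insert p {p'})
    (hrows : ∀ i, u i ⊆ T ∧ (u i).card ≤ 3) (hcount : S.card < Nat.choose (S.card - T.card + 1) 2) :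
    (Matrix.of fun i k : n => ∏ a ∈ u i, (tx none a + ∑ q ∈ e k, tx (some q) a)).det = 0 := by
  obtain ⟨β, hsym, hdiag, hΛ, hne⟩ := exists_syzygyMatrix tx S T hcount
  exact det_eq_zero_of_syzygy tx u e he S T β h0 h1 h2 hsym hdiag hΛ hne hrows

end closed

end SymSyzygy

end

end Summit.ValiantsHypothesis.ValiantsHypothesis.Theorems.BarrierLever.HiddenStates
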